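import Summits.KontsevichZagierPeriods.KontsevichZagierPeriods.Theorems.HurwitzMicroSectorsNormalFormPrincipleLevelTwoEvenReduction

/-!
# `NormalFormPrinciple` (stmt-KontsevichZagierPeriods-3869), line `SketchIdeator1` — leaf `stub_boxRigidity`:
# LEVEL TWO WITH REAL-ALGEBRAIC COEFFICIENTS: Conjecture 1 (kernel form) on the even layer

On the subgroup of `FormalRep` generated by the even level-two boxes `[(0,1)², P/(1 − x²y²)]`
(`P ∈ (ℚ̄ ∩ ℝ)[x,y]`, `P(−x,−y) = P(x,y)`), the algebraic level-one boxes `[(0,1)², Q/(1 − xy)]` and the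
algebraic points `[pt, r]`, every element has the normal form `[(0,1)², β/(1−xy)] + [pt, q]` modulo
`relations` with `β, q` real algebraic (`exists_normalForm_of_mem_evenClosure`); its value is
`β·π²/6 + q`, rigid by the transcendence of `π` (Lindemann, `transcendental_pi_holds`, through
`AlgLevelOne.alg_rigid_kit`), so value `0` forces a relation: CONJECTURE 1 OF KONTSEVICH–ZAGIER HOLDS
ON THE EVEN LEVEL-TWO LAYER UNCONDITIONALLY (`levelTwoEven_mem_relations_of_eval_eq_zero_of_mem_closure`).
Corollaries: two even boxes with equal values are equivalent; the alternating box
`[(0,1)², c/(1+xy)]` (value `c·π²/12`) is equivalent to the ζ-box `[(0,1)², c'/(1−xy)]` whenever the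
values agree, e.g. `2∫∫dxdy/(1+xy) = ∫∫dxdy/(1−xy)` (`alternatingBox_equivalent_zetaBox_of_value_eq`).
[cite: KontsevichZagier2001, §1.2 Conjecture 1] No new definitions.
-/

noncomputable section

open MeasureTheory Set
open Literature.NumberTheory.Transcendental Literature.NumberTheory.Transcendental.KZ
open Literature.ModelTheory.ExponentialFields (IsSemialgebraic)

namespace Summit.KontsevichZagierPeriods.HurwitzMicroSectors.NormalFormPrinciple.PiBox.AlgLevelTwo

open Summit.KontsevichZagierPeriods.HurwitzMicroSectors.NormalFormPrinciple.PiBox.Dlog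
  (pt_zero_mem_relations pt_congr_mem_relations exists_ptCarrierA)
open Summit.KontsevichZagierPeriods.HurwitzMicroSectors.NormalFormPrinciple.PiBox.LevelOne
  (one_sub_mul_pos_of_mem_box)
open Summit.KontsevichZagierPeriods.HurwitzMicroSectors.NormalFormPrinciple.PiBox.AlgLevelOne
  (alg_exists_reps alg_rigid_kit alg_monomials_to_points alg_monomial_normalForm alg_levelOne_normalForm
    isAlgebraic_ratCast_mul isAlgebraic_add' isAlgebraic_neg' zetaBoxA_zero_mem_relations
    mvPolynomial_eval_eq_sum_two)

/-- **Normal forms on the subgroup** generated by the even level-two boxes, the algebraic level-one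
boxes `[(0,1)², P/(1−xy)]` and the algebraic points. [cite: KontsevichZagier2001, §1.2] -/
theorem exists_normalForm_of_mem_evenClosure {x : FormalRep}
    (hx : x ∈ AddSubgroup.closure
      ({y : FormalRep | ∃ (P : MvPolynomial (Fin 2) ℝ) (N : IntegralRep 2),
          (∀ s, IsAlgebraic ℚ (P.coeff s)) ∧ (∀ s ∈ P.support, Even (s 0 + s 1)) ∧
          N.domain = {x | ∀ i, x i ∈ Set.Ioo (0:ℝ) 1} ∧
          EqOn N.integrand (fun x => MvPolynomial.eval x P / (1 - x 0 ^ 2 * x 1 ^ 2)) N.domain ∧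
          y = of N} ∪
       {y : FormalRep | ∃ (P : MvPolynomial (Fin 2) ℝ) (N : IntegralRep 2),
          (∀ s, IsAlgebraic ℚ (P.coeff s)) ∧ N.domain = {x | ∀ i, x i ∈ Set.Ioo (0:ℝ) 1} ∧
          EqOn N.integrand (fun x => MvPolynomial.eval x P / (1 - x 0 * x 1)) N.domain ∧ y = of N} ∪
       {y : FormalRep | ∃ (r : ℝ) (Z : IntegralRep 0), IsAlgebraic ℚ r ∧ Z.domain = Set.univ ∧
          (Z.integrand = fun _ => r) ∧ y = of Z})) :
    ∃ β q : ℝ, IsAlgebraic ℚ β ∧ IsAlgebraic ℚ q ∧ ∀ (B : IntegralRep 2) (Z : IntegralRep 0),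
      B.domain = {x | ∀ i, x i ∈ Set.Ioo (0:ℝ) 1} →
      EqOn B.integrand (fun x => β / (1 - x 0 * x 1)) B.domain →
      Z.domain = Set.univ → (Z.integrand = fun _ => q) → x - of B - of Z ∈ relations := by
  obtain ⟨-, -, -, hBadd, hptadd, hexB⟩ := alg_rigid_kit
  obtain ⟨Zf, hZf⟩ := exists_ptCarrierA
  induction hx using AddSubgroup.closure_induction with
  | mem y hy =>
    rcases hy with (hy | hy) | hy
    · obtain ⟨P, N, hP, hev, hNd, hNi, rfl⟩ := hy
      exact levelTwo_normalForm_even P hP hev N hNd hNi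
    · obtain ⟨P, N, hP, hNd, hNi, rfl⟩ := hy
      exact alg_levelOne_normalForm P hP N hNd hNi
    · obtain ⟨r, Z₀, hr, hZ₀d, hZ₀i, rfl⟩ := hy
      refine ⟨0, r, isAlgebraic_zero, hr, fun B Z _ hBi hZd hZi => ?_⟩
      have hB := zetaBoxA_zero_mem_relations B hBi
      have hZ := pt_congr_mem_relations Z₀ Z hZ₀d hZd hZ₀i hZi
      have e : of Z₀ - of B - of Z = (of Z₀ - of Z) - of B := by abel
      rw [e]
      exact relations.sub_mem hZ hB
  | zero =>
    refine ⟨0, 0, isAlgebraic_zero, isAlgebraic_zero, fun B Z _ hBi _ hZi => ?_⟩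
    have hB := zetaBoxA_zero_mem_relations B hBi
    have hZ := pt_zero_mem_relations Z hZi
    have e : (0 : FormalRep) - of B - of Z = -(of B) - of Z := by abel
    rw [e]
    exact relations.sub_mem (relations.neg_mem hB) hZ
  | add y z _ _ ihy ihz =>
    obtain ⟨β₁, q₁, hβ₁, hq₁, h₁⟩ := ihy
    obtain ⟨β₂, q₂, hβ₂, hq₂, h₂⟩ := ihz
    refine ⟨β₁ + β₂, q₁ + q₂, isAlgebraic_add' hβ₁ hβ₂, isAlgebraic_add' hq₁ hq₂,
      fun B Z hBd hBi hZd hZi => ?_⟩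
    obtain ⟨B₁, hB₁d, hB₁i⟩ := hexB β₁ hβ₁
    obtain ⟨B₂, hB₂d, hB₂i⟩ := hexB β₂ hβ₂
    have e₁ := h₁ B₁ (Zf q₁) hB₁d (hB₁i ▸ fun _ _ => rfl) (hZf q₁ hq₁).1 (hZf q₁ hq₁).2
    have e₂ := h₂ B₂ (Zf q₂) hB₂d (hB₂i ▸ fun _ _ => rfl) (hZf q₂ hq₂).1 (hZf q₂ hq₂).2
    have eB := hBadd β₁ β₂ B B₁ B₂ hBd hBi hB₁d (hB₁i ▸ fun _ _ => rfl) hB₂d (hB₂i ▸ fun _ _ => rfl)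
    have eZ := hptadd q₁ q₂ Z (Zf q₁) (Zf q₂) hZd hZi (hZf q₁ hq₁).1 (hZf q₁ hq₁).2 (hZf q₂ hq₂).1
      (hZf q₂ hq₂).2
    have e : y + z - of B - of Z = (y - of B₁ - of (Zf q₁)) + (z - of B₂ - of (Zf q₂))
        - (of B - of B₁ - of B₂) - (of Z - of (Zf q₁) - of (Zf q₂)) := by abel
    rw [e]
    exact relations.sub_mem (relations.sub_mem (relations.add_mem e₁ e₂) eB) eZ
  | neg y _ ihy =>
    obtain ⟨β, q, hβ, hq, h⟩ := ihy
    refine ⟨-β, -q, isAlgebraic_neg' hβ, isAlgebraic_neg' hq, fun B Z hBd hBi hZd hZi => ?_⟩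
    obtain ⟨B₁, hB₁d, hB₁i⟩ := hexB β hβ
    obtain ⟨B₀, hB₀d, hB₀i⟩ := hexB 0 isAlgebraic_zero
    have e₁ := h B₁ (Zf q) hB₁d (hB₁i ▸ fun _ _ => rfl) (hZf q hq).1 (hZf q hq).2
    have eB := hBadd β (-β) B₀ B₁ B hB₀d (fun x hx => by rw [hB₀i]; simp) hB₁d (hB₁i ▸ fun _ _ => rfl)
      hBd hBi
    have eB0 := zetaBoxA_zero_mem_relations B₀ (hB₀i ▸ fun _ _ => rfl)
    have eZ := hptadd q (-q) (Zf 0) (Zf q) Z (hZf 0 isAlgebraic_zero).1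
      (by rw [(hZf 0 isAlgebraic_zero).2]; funext; simp) (hZf q hq).1 (hZf q hq).2 hZd hZi
    have eZ0 := pt_zero_mem_relations (Zf 0) (hZf 0 isAlgebraic_zero).2
    have e : -y - of B - of Z = -(y - of B₁ - of (Zf q)) + (of B₀ - of B₁ - of B) - of B₀
        + (of (Zf 0) - of (Zf q) - of Z) - of (Zf 0) := by abel
    rw [e]
    exact relations.sub_mem (relations.add_mem (relations.sub_mem (relations.add_mem
      (relations.neg_mem e₁) eB) eB0) eZ) eZ0

/-- **Conjecture 1 of Kontsevich–Zagier, kernel form, for the EVEN LEVEL-TWO LAYER** — unconditionally: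
a formal `ℤ`-combination of boxes `[(0,1)², P/(1 − x²y²)]` (`P ∈ (ℚ̄ ∩ ℝ)[x,y]` even:
`P(−x,−y) = P(x,y)`; values in `ℚ̄ + ℚ̄·π²`, e.g. `∫∫ dxdy/(1−x²y²) = π²/8`, `∫∫ dxdy/(1+xy) = π²/12`), of
algebraic level-one boxes `[(0,1)², Q/(1−xy)]` and of algebraic points, with value `0`, is a relation.
Normal form `[(0,1)², β/(1−xy)] + [pt, q]`, value `βπ²/6 + q`, rigid by the transcendence of `π`
(Lindemann, `transcendental_pi_holds`). [cite: KontsevichZagier2001, §1.2 Conjecture 1] -/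
theorem levelTwoEven_mem_relations_of_eval_eq_zero_of_mem_closure {x : FormalRep}
    (hx : x ∈ AddSubgroup.closure
      ({y : FormalRep | ∃ (P : MvPolynomial (Fin 2) ℝ) (N : IntegralRep 2),
          (∀ s, IsAlgebraic ℚ (P.coeff s)) ∧ (∀ s ∈ P.support, Even (s 0 + s 1)) ∧
          N.domain = {x | ∀ i, x i ∈ Set.Ioo (0:ℝ) 1} ∧
          EqOn N.integrand (fun x => MvPolynomial.eval x P / (1 - x 0 ^ 2 * x 1 ^ 2)) N.domain ∧
          y = of N} ∪
       {y : FormalRep | ∃ (P : MvPolynomial (Fin 2) ℝ) (N : IntegralRep 2),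
          (∀ s, IsAlgebraic ℚ (P.coeff s)) ∧ N.domain = {x | ∀ i, x i ∈ Set.Ioo (0:ℝ) 1} ∧
          EqOn N.integrand (fun x => MvPolynomial.eval x P / (1 - x 0 * x 1)) N.domain ∧ y = of N} ∪
       {y : FormalRep | ∃ (r : ℝ) (Z : IntegralRep 0), IsAlgebraic ℚ r ∧ Z.domain = Set.univ ∧
          (Z.integrand = fun _ => r) ∧ y = of Z}))
    (hv : eval x = 0) : x ∈ relations := by
  obtain ⟨hrigid, hvalB, hvalZ, -, -, hexB⟩ := alg_rigid_kit
  obtain ⟨Zf, hZf⟩ := exists_ptCarrierA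
  obtain ⟨β, q, hβ, hq, h⟩ := exists_normalForm_of_mem_evenClosure hx
  obtain ⟨B, hBd, hBi⟩ := hexB β hβ
  have e₁ := h B (Zf q) hBd (hBi ▸ fun _ _ => rfl) (hZf q hq).1 (hZf q hq).2
  have h0 := relations_le_ker_eval_holds e₁
  rw [AddMonoidHom.mem_ker, map_sub, map_sub, hv, eval_of, eval_of, hvalB β B hBd (hBi ▸ fun _ _ => rfl),
    hvalZ q (Zf q) (hZf q hq).1 (hZf q hq).2] at h0
  obtain ⟨rfl, rfl⟩ := hrigid β q 0 0 hβ hq isAlgebraic_zero isAlgebraic_zero (by linarith)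
  have eB := zetaBoxA_zero_mem_relations B (hBi ▸ fun _ _ => rfl)
  have eZ := pt_zero_mem_relations (Zf 0) (hZf 0 isAlgebraic_zero).2
  have e : x = (x - of B - of (Zf 0)) + of B + of (Zf 0) := by abel
  rw [e]
  exact relations.add_mem (relations.add_mem e₁ eB) eZ

/-- **Two even level-two boxes with equal values are KZ-equivalent** (unconditionally).
[cite: KontsevichZagier2001, §1.2 Conjecture 1] -/
theorem levelTwoEven_equivalent_of_value_eq (N N' : IntegralRep 2) (P P' : MvPolynomial (Fin 2) ℝ)
    (hP : ∀ s, IsAlgebraic ℚ (P.coeff s)) (hev : ∀ s ∈ P.support, Even (s 0 + s 1))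
    (hP' : ∀ s, IsAlgebraic ℚ (P'.coeff s)) (hev' : ∀ s ∈ P'.support, Even (s 0 + s 1))
    (hNd : N.domain = {x | ∀ i, x i ∈ Set.Ioo (0:ℝ) 1})
    (hNi : EqOn N.integrand (fun x => MvPolynomial.eval x P / (1 - x 0 ^ 2 * x 1 ^ 2)) N.domain)
    (hN'd : N'.domain = {x | ∀ i, x i ∈ Set.Ioo (0:ℝ) 1})
    (hN'i : EqOn N'.integrand (fun x => MvPolynomial.eval x P' / (1 - x 0 ^ 2 * x 1 ^ 2)) N'.domain)
    (hv : N.value = N'.value) : Equivalent N N' := by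
  refine levelTwoEven_mem_relations_of_eval_eq_zero_of_mem_closure (AddSubgroup.sub_mem _
    (AddSubgroup.subset_closure (Or.inl (Or.inl ⟨P, N, hP, hev, hNd, hNi, rfl⟩)))
    (AddSubgroup.subset_closure (Or.inl (Or.inl ⟨P', N', hP', hev', hN'd, hN'i, rfl⟩)))) ?_
  rw [map_sub, eval_of, eval_of, hv, sub_self]

/-- **The alternating box `[(0,1)², c/(1 + xy)]` against a ζ-box `[(0,1)², c'/(1 − xy)]`** (values
`c·π²/12`, `c'·π²/6`): equal values imply KZ-equivalence, unconditionally — e.g. `c = 2`, `c' = 1`.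
Here `c/(1+xy) = (c − c·xy)/(1 − x²y²)` is an even level-two box. [cite: KontsevichZagier2001, §1.2] -/
theorem alternatingBox_equivalent_zetaBox_of_value_eq (c c' : ℝ) (hc : IsAlgebraic ℚ c)
    (hc' : IsAlgebraic ℚ c') (N N' : IntegralRep 2) (hNd : N.domain = {x | ∀ i, x i ∈ Set.Ioo (0:ℝ) 1})
    (hNi : EqOn N.integrand (fun x => c / (1 + x 0 * x 1)) N.domain)
    (hN'd : N'.domain = {x | ∀ i, x i ∈ Set.Ioo (0:ℝ) 1})
    (hN'i : EqOn N'.integrand (fun x => c' / (1 - x 0 * x 1)) N'.domain)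
    (hv : N.value = N'.value) : Equivalent N N' := by
  classical
  -- `P = c − c·x0·x1`, `P' = c'`
  set m : Fin 2 →₀ ℕ := Finsupp.single 0 1 + Finsupp.single 1 1 with hm
  have hm0 : (0 : Fin 2 →₀ ℕ) ≠ m := by
    intro h
    have := congrArg (fun f : Fin 2 →₀ ℕ => f 0) h
    simp [hm] at this
  have hmemN : of N ∈ ({y : FormalRep | ∃ (P : MvPolynomial (Fin 2) ℝ) (N : IntegralRep 2),
      (∀ s, IsAlgebraic ℚ (P.coeff s)) ∧ (∀ s ∈ P.support, Even (s 0 + s 1)) ∧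
      N.domain = {x | ∀ i, x i ∈ Set.Ioo (0:ℝ) 1} ∧
      EqOn N.integrand (fun x => MvPolynomial.eval x P / (1 - x 0 ^ 2 * x 1 ^ 2)) N.domain ∧
      y = of N}) := by
    refine ⟨MvPolynomial.monomial 0 c - MvPolynomial.monomial m c, N, fun s => ?_, fun s hs => ?_, hNd,
      fun x hx => ?_, rfl⟩
    · rw [MvPolynomial.coeff_sub, MvPolynomial.coeff_monomial, MvPolynomial.coeff_monomial]
      split_ifs
      · exact isAlgebraic_sub' hc hc
      · simpa using hc
      · simpa using isAlgebraic_neg' hc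
      · simpa using isAlgebraic_zero
    · rw [MvPolynomial.mem_support_iff, MvPolynomial.coeff_sub, MvPolynomial.coeff_monomial,
        MvPolynomial.coeff_monomial] at hs
      by_cases h0 : (0 : Fin 2 →₀ ℕ) = s
      · subst h0
        simp
      · by_cases h1 : m = s
        · subst h1
          simp [hm, Finsupp.add_apply]
        · simp [h0, h1] at hs
    · rw [hNd] at hx
      have h1 : (0:ℝ) < 1 - x 0 * x 1 := one_sub_mul_pos_of_mem_box hx
      have h3 : (0:ℝ) < 1 + x 0 * x 1 := by
        have := (hx 0).1; have := (hx 1).1; positivity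
      rw [hNi (hNd ▸ hx)]
      beta_reduce
      rw [map_sub, eval_monomial_two, eval_monomial_two]
      have e2 : (1:ℝ) - x 0 ^ 2 * x 1 ^ 2 = (1 - x 0 * x 1) * (1 + x 0 * x 1) := by ring
      rw [e2]
      field_simp
      simp [hm, Finsupp.add_apply]
  have hmemN' : of N' ∈ ({y : FormalRep | ∃ (P : MvPolynomial (Fin 2) ℝ) (N : IntegralRep 2),
      (∀ s, IsAlgebraic ℚ (P.coeff s)) ∧ N.domain = {x | ∀ i, x i ∈ Set.Ioo (0:ℝ) 1} ∧
      EqOn N.integrand (fun x => MvPolynomial.eval x P / (1 - x 0 * x 1)) N.domain ∧ y = of N}) := by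
    refine ⟨MvPolynomial.monomial 0 c', N', fun s => ?_, hN'd, fun x hx => ?_, rfl⟩
    · rw [MvPolynomial.coeff_monomial]
      split_ifs
      · exact hc'
      · exact isAlgebraic_zero
    · rw [hN'i hx]
      simp
  refine levelTwoEven_mem_relations_of_eval_eq_zero_of_mem_closure (AddSubgroup.sub_mem _
    (AddSubgroup.subset_closure (Or.inl (Or.inl hmemN)))
    (AddSubgroup.subset_closure (Or.inl (Or.inr hmemN')))) ?_
  rw [map_sub, eval_of, eval_of, hv, sub_self]

end Summit.KontsevichZagierPeriods.HurwitzMicroSectors.NormalFormPrinciple.PiBox.AlgLevelTwo
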